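/-
Copyright (c) 2026. All rights reserved.
Released under Apache 2.0 license as described in the file LICENSE.
Authors: abc-iut cell, seat abc-iut-w5-d226 (gen 2; sub-DAG `AbsTopIII:Prop4.2` of
plan/L4/SUBDAG-AbsTopIII-Prop42.md at the MODEL, for the monoid types `TM, TLG, TCG`; part 1/2).
-/
import Literature.AnabelianGeometry.AbsoluteAnabelian.ArchimedeanHolPairs
import Literature.AnabelianGeometry.AbsoluteAnabelian.ArchimedeanLogFrobeniusProp42Sub
import HarnessLib

/-!
# [AbsTopIII] Def 4.1 (i)–(iii): the categories `𝒞^hol_T` for the MONOID types `T ∈ {TM, TLG, TCG}` (model)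

S. Mochizuki, *Topics in absolute anabelian geometry III*, §4: Def 4.1 (i)–(iii) pp. 101–103, Prop 4.2
(i) pp. 105–106 of the author's kurims manuscript (lit key `paper:url-5493eb38cbb7`, read on the page;
bib key `MochizukiAbsTopIII2015`).

abc-iut-L4-t10's MODEL of §4 (`ArchimedeanHolCategories` / `ArchimedeanHolPairs` /
`ArchimedeanLogFrobeniusModel`: the interface `𝔄 : AutHolFieldFunctor` = Cor 2.7 (e) + functoriality and
the categories `𝒞^hol_TF = HolTFPair 𝔄`, `𝒞^hol_TH = HolTHPair 𝔄`) is written for `T = TF`; its docstring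
records "Scope: `T = TF` (the `TM` twin replaces `k` by `𝒪_k^⊳` — TODO(general form))".  Prop 4.2 as
PRINTED quantifies `T ∈ {TM, TF, TLG, TCG}` in (i) and factors `𝔩𝔬𝔤_{TF,T}` through `𝒞^hol_TM` in (ii).  This
file and its sequel `ArchimedeanHolMonoidPairsLogFrobenius.lean` supply the three MONOID types over the
same interface (nothing at `TF`/`TH`, which are abc-iut-L4-t10's).  Here:

* Def 4.1 (i)/(iii): the arithmetic data `M_T(k) ⊆ k` — `𝒪_k^⊳` (`TM`), `k^×` (`TLG`), `𝒪_k^×` (`TCG`) — as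
  multiplicative submonoids of the CAF `k` (`ArchPairType.arithSubmonoid`; for a model pair of
  abc-iut-L4-t14's `ModelAutHolPair` this IS its `arithData`, `ModelAutHolPair.arithData_eq_coe_arithSubmonoid`
  — no notion is re-declared), `k^×` as the groupification of `𝒪_k^⊳` inside `k`
  (`exists_div_eq_of_mem_TLG`), and their INTRINSIC nature ("the formation of `𝒪_k^⊳` (respectively, `k^×`;
  `𝒪_k^×`; `𝒪_k^×`) from `k` … is clearly intrinsically defined", Def 4.1 (iii) p. 103): bicontinuous field
  isomorphisms preserve them (`ArchPairType.map_mem_arithSubmonoid_iff`, from abc-iut-w5-d226 gen 0's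
  `ArchProp42.norm_le_one_iff`, `….norm_eq_one_iff`);
* Def 4.1 (ii)(iii): the categories **`𝒞^hol_T` for `T ∈ {TM, TLG, TCG}`** (`HolMonoidPair 𝔄 T`): objects the
  model `T`-pairs `(𝕏_ell ↶ M_T(k))` — the `TF` datum `(𝕏, k, κ_k)` of abc-iut-L4-t10's `HolTFPair 𝔄` read
  through "`κ_{M_k}` … the restriction of `κ_k` to `M_k ⊆ k`" (Def 4.1 (i) (c); every Aut-holomorphic
  `T`-pair is isomorphic to a model one, Def 4.1 (ii) (c), so the model pairs give `𝒞^hol_T` up to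
  equivalence); morphisms `(φ_𝕏, φ_M)` with `φ_M : M_T(k₁) → M_T(k₂)` a continuous homomorphism of
  topological monoids ("a morphism of objects of `T`", `T` as in Def 3.1 (i): topological monoids /
  locally compact / compact abelian topological groups and their continuous homomorphisms) and `φ_𝕏` finite
  étale, "compatible [relative to the respective Kummer structures]" (`HolMonoidPair.Hom`, `category`);
* the field isomorphism `κ₂⁻¹ ∘ 𝒜_{φ_𝕏} ∘ κ₁` of a finite étale `φ_𝕏` (`fieldIso`), which maps `M_T(k₁)` onto
  `M_T(k₂)` (`fieldIso_mem_iff`), DETERMINES `φ_M` (`Hom.arith_coe`, `Hom.ext_of_base`) and LIFTS `φ_𝕏`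
  (`Hom.ofBase`) — the two halves of the bijectivity portion of Prop 4.2 (i) ("follows immediately from the
  required compatibility of morphisms of `𝒞^hol_T` with the Kummer structures"), assembled in the sequel.

Refereed pre-IUT anabelian geometry; a MODEL (kernel definitions) over a named interface; the existence
of `𝔄` on the geometric carriers (the algorithms of Cor 2.7) is NOT asserted; nothing here bears on
[IUTchIII] Cor. 3.12 or takes a side; typed ≠ discharged except where a proof is given.
-/

set_option autoImplicit false

noncomputable section

namespace Literature.AnabelianGeometry.AbsoluteAnabelian

open _root_.CategoryTheory _root_.Topology

universe u

/-! ### Def 4.1 (i)/(iii): the monoid types and their arithmetic data `M_T(k) ⊆ k` -/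

/-- The three **monoid types** among the algebraic types of Def 4.1 (i): `TM` (`M_k = 𝒪_k^⊳`, a
topological monoid), `TLG` (`M_k = k^×`), `TCG` (`M_k = 𝒪_k^×`) (topological groups) — those `T ≠ TF` for
which the model object `M_k` is a multiplicative submonoid of `k` ("`TF, TCG, TLG, TM` as in Definition
3.1, (i)"). [cite: MochizukiAbsTopIII2015, Definition 4.1 (i) p.102] -/
def ArchPairType.IsMonoidType (T : ArchPairType) : Prop := T = .TM ∨ T = .TLG ∨ T = .TCG

/-- `TM` is a monoid type. [cite: MochizukiAbsTopIII2015, Definition 4.1 (i) p.102] -/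
theorem ArchPairType.isMonoidType_TM : ArchPairType.TM.IsMonoidType := Or.inl rfl
/-- `TLG` is a monoid type. [cite: MochizukiAbsTopIII2015, Definition 4.1 (i) p.102] -/
theorem ArchPairType.isMonoidType_TLG : ArchPairType.TLG.IsMonoidType := Or.inr (Or.inl rfl)
/-- `TCG` is a monoid type. [cite: MochizukiAbsTopIII2015, Definition 4.1 (i) p.102] -/
theorem ArchPairType.isMonoidType_TCG : ArchPairType.TCG.IsMonoidType := Or.inr (Or.inr rfl)

/-- A monoid type is algebraic (has a model object inside `k`). [cite: MochizukiAbsTopIII2015, Definition 4.1 (i) p.102] -/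
theorem ArchPairType.IsMonoidType.isAlgebraic {T : ArchPairType} (hT : T.IsMonoidType) :
    T.IsAlgebraic := by
  rcases hT with rfl | rfl | rfl <;> exact ⟨by decide, by decide⟩

/-- **The arithmetic data `M_T(k) ⊆ k` as a multiplicative submonoid of the CAF `k`**: `k` (`TF`),
`𝒪_k^× = {‖x‖ = 1}` (`TCG`), `k^× = {x ≠ 0}` (`TLG`), `𝒪_k^⊳ = {x ≠ 0, ‖x‖ ≤ 1}` (`TM`) ("`𝒪_k ⊆ k` the subset
of elements of absolute value `≤ 1`, `𝒪_k^× ⊆ 𝒪_k` the subgroup of units, `𝒪_k^⊳ ⊆ 𝒪_k` the multiplicative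
monoid of nonzero elements"); for `TH`, `TH⊞` (no model object inside `k`) the placeholder `⊤`.
[cite: MochizukiAbsTopIII2015, Definition 4.1 (i) p.101] -/
def ArchPairType.arithSubmonoid (T : ArchPairType) (k : Type u) [NormedField k] : Submonoid k :=
  match T with
  | .TF => ⊤
  | .TCG =>
    { carrier := {x | ‖x‖ = 1}
      one_mem' := by simp
      mul_mem' := fun {a b} ha hb => by
        simp only [Set.mem_setOf_eq, norm_mul] at ha hb ⊢
        rw [ha, hb, one_mul] }
  | .TLG =>
    { carrier := {x | x ≠ 0}
      one_mem' := one_ne_zero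
      mul_mem' := fun {a b} ha hb => mul_ne_zero ha hb }
  | .TM =>
    { carrier := {x | x ≠ 0 ∧ ‖x‖ ≤ 1}
      one_mem' := ⟨one_ne_zero, by simp⟩
      mul_mem' := fun {a b} ha hb => by
        simp only [Set.mem_setOf_eq, norm_mul] at ha hb ⊢
        exact ⟨mul_ne_zero ha.1 hb.1, mul_le_one₀ ha.2 (norm_nonneg _) hb.2⟩ }
  | .TH => ⊤
  | .THadd => ⊤

section ArithSubmonoid

variable {k : Type u} [NormedField k] {k' : Type u} [NormedField k']

/-- Membership in `𝒪_k^⊳`. [cite: MochizukiAbsTopIII2015, Definition 4.1 (i) p.101] -/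
theorem ArchPairType.mem_arithSubmonoid_TM (x : k) :
    x ∈ ArchPairType.TM.arithSubmonoid k ↔ x ≠ 0 ∧ ‖x‖ ≤ 1 := Iff.rfl

/-- Membership in `k^×`. [cite: MochizukiAbsTopIII2015, Definition 4.1 (i) p.101] -/
theorem ArchPairType.mem_arithSubmonoid_TLG (x : k) :
    x ∈ ArchPairType.TLG.arithSubmonoid k ↔ x ≠ 0 := Iff.rfl

/-- Membership in `𝒪_k^×`. [cite: MochizukiAbsTopIII2015, Definition 4.1 (i) p.101] -/
theorem ArchPairType.mem_arithSubmonoid_TCG (x : k) :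
    x ∈ ArchPairType.TCG.arithSubmonoid k ↔ ‖x‖ = 1 := Iff.rfl

/-- `𝒪_k^× ⊆ 𝒪_k^⊳` ("the subgroup of invertible elements `M^×` of the arithmetic data `M`", Def 4.1 (iii)).
[cite: MochizukiAbsTopIII2015, Definition 4.1 (iii) p.103] -/
theorem ArchPairType.arithSubmonoid_TCG_le_TM :
    ArchPairType.TCG.arithSubmonoid k ≤ ArchPairType.TM.arithSubmonoid k := fun x hx => by
  rw [ArchPairType.mem_arithSubmonoid_TCG] at hx
  exact ⟨norm_ne_zero_iff.1 (by rw [hx]; exact one_ne_zero), hx.le⟩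

/-- `𝒪_k^⊳ ⊆ k^×` (the groupification `M^gp` of `M = 𝒪_k^⊳` is realised inside `k` as `k^×`, Def 4.1 (iii)).
[cite: MochizukiAbsTopIII2015, Definition 4.1 (iii) p.103] -/
theorem ArchPairType.arithSubmonoid_TM_le_TLG :
    ArchPairType.TM.arithSubmonoid k ≤ ArchPairType.TLG.arithSubmonoid k := fun _ hx => hx.1

/-- `k^×` IS the groupification of `𝒪_k^⊳` inside `k`: every nonzero `x` is a quotient `a / b` of elements of
`𝒪_k^⊳` ("the associated groupification `M^gp` of the arithmetic data `M`").
[cite: MochizukiAbsTopIII2015, Definition 4.1 (iii) p.103] -/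
theorem ArchPairType.exists_div_eq_of_mem_TLG {x : k} (hx : x ∈ ArchPairType.TLG.arithSubmonoid k) :
    ∃ a b : k, a ∈ ArchPairType.TM.arithSubmonoid k ∧ b ∈ ArchPairType.TM.arithSubmonoid k ∧
      x = a / b := by
  rw [ArchPairType.mem_arithSubmonoid_TLG] at hx
  by_cases h : ‖x‖ ≤ 1
  · exact ⟨x, 1, ⟨hx, h⟩, ⟨one_ne_zero, by simp⟩, by simp⟩
  · refine ⟨1, x⁻¹, ⟨one_ne_zero, by simp⟩, ⟨inv_ne_zero hx, ?_⟩, by simp⟩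
    rw [norm_inv]
    exact inv_le_one_of_one_le₀ (le_of_not_ge h)

/-- **The arithmetic data are intrinsic to the topological field** (Def 4.1 (iii): "the formation of
`𝒪_k^⊳` (respectively, `k^×`; `𝒪_k^×`; `𝒪_k^×`) from `k` (respectively, `𝒪_k^⊳`; `𝒪_k^⊳`; `k^×`) is clearly
intrinsically defined"): a bicontinuous field isomorphism `σ : k ⥲ k'` satisfies `σ x ∈ M_T(k') ↔ x ∈ M_T(k)`.
[cite: MochizukiAbsTopIII2015, Definition 4.1 (iii) p.103] -/
theorem ArchPairType.map_mem_arithSubmonoid_iff (T : ArchPairType) (σ : k ≃+* k') (hσ : Continuous σ)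
    (hσ' : Continuous σ.symm) (x : k) : σ x ∈ T.arithSubmonoid k' ↔ x ∈ T.arithSubmonoid k := by
  cases T with
  | TF => simp [ArchPairType.arithSubmonoid]
  | TCG =>
    rw [ArchPairType.mem_arithSubmonoid_TCG, ArchPairType.mem_arithSubmonoid_TCG]
    exact ArchProp42.norm_eq_one_iff σ hσ hσ' x
  | TLG =>
    rw [ArchPairType.mem_arithSubmonoid_TLG, ArchPairType.mem_arithSubmonoid_TLG]
    exact map_ne_zero σ
  | TM =>
    rw [ArchPairType.mem_arithSubmonoid_TM, ArchPairType.mem_arithSubmonoid_TM]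
    exact and_congr (map_ne_zero σ) (ArchProp42.norm_le_one_iff σ hσ hσ' x)
  | TH => simp [ArchPairType.arithSubmonoid]
  | THadd => simp [ArchPairType.arithSubmonoid]

end ArithSubmonoid

/-- For a model Aut-holomorphic `T`-pair of abc-iut-L4-t14's `ModelAutHolPair` (necessarily of algebraic
type) the arithmetic data `M_k ⊆ k` IS the submonoid `M_T(k)` (bridge; no notion is re-declared).
[cite: MochizukiAbsTopIII2015, Definition 4.1 (i) p.102] -/
theorem ModelAutHolPair.arithData_eq_coe_arithSubmonoid {T : ArchPairType} (P : ModelAutHolPair.{u} T) :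
    P.arithData = (T.arithSubmonoid P.k : Set P.k) := by
  obtain ⟨h₁, h₂⟩ := P.algebraic
  cases T with
  | TF => simp [ModelAutHolPair.arithData, ArchPairType.arithSubmonoid]
  | TCG => exact Set.ext fun _ => Iff.rfl
  | TLG => exact Set.ext fun _ => Iff.rfl
  | TM => exact Set.ext fun _ => Iff.rfl
  | TH => exact absurd rfl h₁
  | THadd => exact absurd rfl h₂

/-! ### Def 4.1 (ii)(iii): the categories `𝒞^hol_T`, `T ∈ {TM, TLG, TCG}` -/

/-- **An object of `𝒞^hol_T` for a monoid type `T ∈ {TM, TLG, TCG}`** (Def 4.1 (ii)(iii)): the model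
Aut-holomorphic `T`-pair `(𝕏_ell ↶^κ M_T(k))` — "(a) the elliptically admissible Aut-holomorphic orbispace
`𝕏_ell`, (b) the object `M_k ∈ Ob(T)`, (c) the datum `κ_{M_k} : M_k → 𝒜_𝕏_ell`", "`κ_{M_k}` … the restriction
of `κ_k` to `M_k ⊆ k`" (Def 4.1 (i)) — recorded through its `TF` datum `(𝕏, k, κ_k)` = abc-iut-L4-t10's
`HolTFPair 𝔄` and the type tag (every Aut-holomorphic `T`-pair is isomorphic to a model one, Def 4.1 (ii)
(c), so the model pairs give `𝒞^hol_T` up to equivalence).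
[cite: MochizukiAbsTopIII2015, Definition 4.1 (ii) p.102] -/
structure HolMonoidPair (𝔄 : AutHolFieldFunctor.{u}) (T : ArchPairType) : Type (u + 1)
    extends HolTFPair 𝔄 where
  /-- the type is one of `TM`, `TLG`, `TCG` -/
  isMonoidType : T.IsMonoidType

namespace HolMonoidPair

variable {𝔄 : AutHolFieldFunctor.{u}} {T : ArchPairType}

/-- The arithmetic data `M_T(k) ⊆ k` of the pair (`𝒪_k^⊳`, `k^×`, `𝒪_k^×` by type).
[cite: MochizukiAbsTopIII2015, Definition 4.1 (i) p.102] -/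
abbrev M (P : HolMonoidPair 𝔄 T) : Submonoid P.k := T.arithSubmonoid P.k

/-- **The Kummer structure `κ_{M_k} : M_T(k) → 𝒜_𝕏`**, "the restriction of `κ_k` to `M_k ⊆ k`", a monoid
homomorphism. [cite: MochizukiAbsTopIII2015, Definition 4.1 (i) p.102] -/
def κM (P : HolMonoidPair 𝔄 T) : P.M →* 𝔄.A P.X := P.κ.toMonoidHom.comp P.M.subtype

/-- `κ_{M_k}` is `κ_k` on elements. [cite: MochizukiAbsTopIII2015, Definition 4.1 (i) p.102] -/
@[simp] theorem κM_apply (P : HolMonoidPair 𝔄 T) (m : P.M) : P.κM m = P.κ (m : P.k) := rfl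

/-- `κ_{M_k}` is continuous (Def 4.1 (ii) (a)). [cite: MochizukiAbsTopIII2015, Definition 4.1 (ii) p.102] -/
theorem continuous_κM (P : HolMonoidPair 𝔄 T) : Continuous P.κM :=
  P.continuous_κ.comp continuous_subtype_val

/-- `κ_{M_k}` is injective. [cite: MochizukiAbsTopIII2015, Definition 4.1 (ii) p.102] -/
theorem κM_injective (P : HolMonoidPair 𝔄 T) : Function.Injective P.κM :=
  P.κ.injective.comp Subtype.val_injective

/-- **A morphism of Aut-holomorphic `T`-pairs** `(𝕏₁ ↶ M₁) → (𝕏₂ ↶ M₂)`, `T ∈ {TM, TLG, TCG}` (Def 4.1 (ii)):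
"a morphism of objects `φ_M : M₁ → M₂` of `T`" — a continuous homomorphism of topological monoids
(`T` as in Def 3.1 (i)) — "together with a compatible [relative to the respective Kummer structures]
finite étale morphism `φ_𝕏 : 𝕏₁ → 𝕏₂`": `κ₂ (φ_M m) = 𝒜_{φ_𝕏} (κ₁ m)` with `𝒜_{φ_𝕏}` INDUCED by `φ_𝕏`.
[cite: MochizukiAbsTopIII2015, Definition 4.1 (ii) p.102] -/
@[ext]
structure Hom (P Q : HolMonoidPair 𝔄 T) : Type (u + 1) where
  /-- `φ_𝕏`, a finite étale morphism of `EA`. -/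
  base : P.X ⟶ Q.X
  /-- `φ_M : M_T(k₁) → M_T(k₂)`, a homomorphism of monoids … -/
  arith : P.M →* Q.M
  /-- … which is continuous. -/
  continuous_arith : Continuous arith
  /-- Compatibility with the Kummer structures. -/
  compat : ∀ m : P.M, Q.κ (arith m : Q.k) = 𝔄.Amap base (P.κ (m : P.k))

/-- The identity morphism of a pair. [cite: MochizukiAbsTopIII2015, Definition 4.1 (ii) p.102] -/
protected def Hom.id (P : HolMonoidPair 𝔄 T) : Hom P P where
  base := 𝟙 P.X
  arith := MonoidHom.id _
  continuous_arith := continuous_id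
  compat m := by rw [𝔄.Amap_id_apply]; rfl

/-- Composition of morphisms of pairs. [cite: MochizukiAbsTopIII2015, Definition 4.1 (ii) p.102] -/
protected def Hom.comp {P Q R : HolMonoidPair 𝔄 T} (φ : Hom P Q) (ψ : Hom Q R) : Hom P R where
  base := φ.base ≫ ψ.base
  arith := ψ.arith.comp φ.arith
  continuous_arith := ψ.continuous_arith.comp φ.continuous_arith
  compat m := by
    rw [𝔄.Amap_comp_apply, MonoidHom.comp_apply, ψ.compat, φ.compat]

/-- **`𝒞^hol_T` is a category**, `T ∈ {TM, TLG, TCG}` ("the category whose objects are the Aut-holomorphic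
`T`-pairs and whose morphisms are the morphisms of Aut-holomorphic `T`-pairs", Def 4.1 (iii)).
[cite: MochizukiAbsTopIII2015, Definition 4.1 (iii) pp.102–103] -/
instance category : Category.{u + 1} (HolMonoidPair 𝔄 T) where
  Hom := Hom
  id := Hom.id
  comp := Hom.comp
  id_comp φ := by apply Hom.ext <;> simp [Hom.id, Hom.comp]
  comp_id φ := by apply Hom.ext <;> simp [Hom.id, Hom.comp]
  assoc φ ψ χ := by apply Hom.ext <;> simp [Hom.comp, MonoidHom.comp_assoc]

/-- The structure part of an identity is the identity. [cite: MochizukiAbsTopIII2015, Definition 4.1 (ii) p.102] -/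
@[simp] theorem id_base (P : HolMonoidPair 𝔄 T) : (𝟙 P : Hom P P).base = 𝟙 P.X := rfl
/-- The arithmetic part of an identity is the identity. [cite: MochizukiAbsTopIII2015, Definition 4.1 (ii) p.102] -/
@[simp] theorem id_arith_apply (P : HolMonoidPair 𝔄 T) (m : P.M) : (𝟙 P : Hom P P).arith m = m := rfl
/-- The structure part of a composite is the composite. [cite: MochizukiAbsTopIII2015, Definition 4.1 (ii) p.102] -/
@[simp] theorem comp_base {P Q R : HolMonoidPair 𝔄 T} (φ : P ⟶ Q) (ψ : Q ⟶ R) :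
    (φ ≫ ψ).base = φ.base ≫ ψ.base := rfl
/-- The arithmetic part of a composite is the composite. [cite: MochizukiAbsTopIII2015, Definition 4.1 (ii) p.102] -/
@[simp] theorem comp_arith_apply {P Q R : HolMonoidPair 𝔄 T} (φ : P ⟶ Q) (ψ : Q ⟶ R) (m : P.M) :
    (φ ≫ ψ).arith m = ψ.arith (φ.arith m) := rfl

/-- The arithmetic part of a morphism is DETERMINED by its structure part: `φ_M = κ₂⁻¹ ∘ 𝒜_{φ_𝕏} ∘ κ₁` on
`M_T(k₁)`. [cite: MochizukiAbsTopIII2015, Definition 4.1 (ii) p.102] -/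
theorem Hom.arith_coe {P Q : HolMonoidPair 𝔄 T} (φ : P ⟶ Q) (m : P.M) :
    (φ.arith m : Q.k) = Q.κ.symm (𝔄.Amap φ.base (P.κ (m : P.k))) := by
  rw [← φ.compat, RingEquiv.symm_apply_apply]

/-- Two morphisms of `T`-pairs with the same structure part are equal.
[cite: MochizukiAbsTopIII2015, Definition 4.1 (ii) p.102] -/
theorem Hom.ext_of_base {P Q : HolMonoidPair 𝔄 T} {φ ψ : P ⟶ Q} (h : φ.base = ψ.base) : φ = ψ :=
  Hom.ext h (MonoidHom.ext fun m => Subtype.ext (by rw [Hom.arith_coe, Hom.arith_coe, h]))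

/-! ### The field isomorphism `κ₂⁻¹ ∘ 𝒜_φ ∘ κ₁` and the lift of a finite étale morphism -/

/-- The isomorphism of topological fields `κ₂⁻¹ ∘ 𝒜_{φ_𝕏} ∘ κ₁ : k₁ ⥲ k₂` determined by a finite étale
`φ_𝕏 : 𝕏₁ → 𝕏₂` between the structure-orbispaces of two pairs ("the functorial algorithms of Corollary 2.7").
[cite: MochizukiAbsTopIII2015, Proposition 4.2 (i) p.106] -/
def fieldIso (P Q : HolMonoidPair 𝔄 T) (f : P.X ⟶ Q.X) : P.k ≃+* Q.k :=
  (P.κ.trans (𝔄.Amap f)).trans Q.κ.symm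

/-- `κ₂⁻¹ ∘ 𝒜_φ ∘ κ₁` on elements. [cite: MochizukiAbsTopIII2015, Proposition 4.2 (i) p.106] -/
theorem fieldIso_apply (P Q : HolMonoidPair 𝔄 T) (f : P.X ⟶ Q.X) (x : P.k) :
    fieldIso P Q f x = Q.κ.symm (𝔄.Amap f (P.κ x)) := rfl

/-- Its inverse on elements. [cite: MochizukiAbsTopIII2015, Proposition 4.2 (i) p.106] -/
theorem fieldIso_symm_apply (P Q : HolMonoidPair 𝔄 T) (f : P.X ⟶ Q.X) (y : Q.k) :
    (fieldIso P Q f).symm y = P.κ.symm ((𝔄.Amap f).symm (Q.κ y)) := rfl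

/-- `κ₂⁻¹ ∘ 𝒜_φ ∘ κ₁` is continuous. [cite: MochizukiAbsTopIII2015, Proposition 4.2 (i) p.106] -/
theorem continuous_fieldIso (P Q : HolMonoidPair 𝔄 T) (f : P.X ⟶ Q.X) : Continuous (fieldIso P Q f) :=
  Q.continuous_κ_symm.comp ((𝔄.continuous_Amap f).comp P.continuous_κ)

/-- … with continuous inverse. [cite: MochizukiAbsTopIII2015, Proposition 4.2 (i) p.106] -/
theorem continuous_fieldIso_symm (P Q : HolMonoidPair 𝔄 T) (f : P.X ⟶ Q.X) :
    Continuous (fieldIso P Q f).symm := by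
  have h : ⇑(fieldIso P Q f).symm = fun y => P.κ.symm ((𝔄.Amap f).symm (Q.κ y)) :=
    funext (fieldIso_symm_apply P Q f)
  rw [h]
  exact P.continuous_κ_symm.comp ((𝔄.continuous_Amap_symm f).comp Q.continuous_κ)

/-- `κ₂⁻¹ ∘ 𝒜_φ ∘ κ₁` maps `M_T(k₁)` exactly onto `M_T(k₂)` (the arithmetic data are intrinsic).
[cite: MochizukiAbsTopIII2015, Definition 4.1 (iii) p.103] -/
theorem fieldIso_mem_iff (P Q : HolMonoidPair 𝔄 T) (f : P.X ⟶ Q.X) (x : P.k) :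
    fieldIso P Q f x ∈ Q.M ↔ x ∈ P.M :=
  T.map_mem_arithSubmonoid_iff (fieldIso P Q f) (continuous_fieldIso P Q f)
    (continuous_fieldIso_symm P Q f) x

/-- **Every finite étale `φ_𝕏 : 𝕏 → 𝕐` lifts to a morphism of `T`-pairs** `(𝕏 ↶ M_T(k)) → (𝕐 ↶ M_T(k'))` with
arithmetic part the restriction of `κ'⁻¹ ∘ 𝒜_{φ_𝕏} ∘ κ` (proof of Prop 4.2 (i): "follows immediately from the
required compatibility of morphisms of `𝒞^hol_T` with the Kummer structures").
[cite: MochizukiAbsTopIII2015, Proposition 4.2 (i) p.106] -/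
def Hom.ofBase (P Q : HolMonoidPair 𝔄 T) (f : P.X ⟶ Q.X) : P ⟶ Q where
  base := f
  arith :=
    { toFun := fun m => ⟨fieldIso P Q f m, (fieldIso_mem_iff P Q f m).2 m.2⟩
      map_one' := Subtype.ext (by simp)
      map_mul' := fun x y => Subtype.ext (by simp) }
  continuous_arith :=
    ((continuous_fieldIso P Q f).comp continuous_subtype_val).subtype_mk _
  compat m := by
    change Q.κ (Q.κ.symm (𝔄.Amap f (P.κ (m : P.k)))) = _
    rw [RingEquiv.apply_symm_apply]

/-- The lift of `φ_𝕏` has structure part `φ_𝕏`. [cite: MochizukiAbsTopIII2015, Proposition 4.2 (i) p.106] -/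
@[simp] theorem Hom.ofBase_base (P Q : HolMonoidPair 𝔄 T) (f : P.X ⟶ Q.X) :
    (Hom.ofBase P Q f).base = f := rfl

/-- The lift of `φ_𝕏` has arithmetic part `κ'⁻¹ ∘ 𝒜_{φ_𝕏} ∘ κ` on `M_T(k)`. [cite: MochizukiAbsTopIII2015, Proposition 4.2 (i) p.106] -/
@[simp] theorem Hom.ofBase_arith_coe (P Q : HolMonoidPair 𝔄 T) (f : P.X ⟶ Q.X) (m : P.M) :
    ((Hom.ofBase P Q f).arith m : Q.k) = fieldIso P Q f m := rfl

/-- Every morphism is the lift of its structure part. [cite: MochizukiAbsTopIII2015, Proposition 4.2 (i) p.106] -/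
theorem Hom.eq_ofBase {P Q : HolMonoidPair 𝔄 T} (φ : P ⟶ Q) : φ = Hom.ofBase P Q φ.base :=
  Hom.ext_of_base rfl

end HolMonoidPair

end Literature.AnabelianGeometry.AbsoluteAnabelian

end
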